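import Summits.SmoothPoincare4.SmoothPoincare4.Theses.WeakReductionDescent
import Literature.Barriers.SmoothPoincare4.LowGenusTrisectionsStandardProofs

/-!
# SmoothPoincare4 / WeakReductionDescent — the base rungs `g ≤ 2` (item stmt-SmoothPoincare4-17911)

Support item `LowGenusBase` of route WeakReductionDescent: a smooth homotopy 4-sphere `M` (the
Statement's bare binders: `M : Type`, Hausdorff, second countable, `C^∞` atlas on `ℝ⁴`, with a
homotopy equivalence `e : M ≃ₕ S⁴`) carrying a Gay–Kirby trisection
(`Literature.Topology.FourManifolds.IsGKTrisection`) of genus `g ≤ 2` is diffeomorphic to `S⁴`.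

This is the homotopy-sphere corollary of Meier–Schirmer–Zupan 2016, Thm. 1.2 / Meier–Zupan 2017,
Thm. 1.2, which the tree carries as the (undischarged) named fact
`Literature.Barriers.SmoothPoincare4.mz_genus_le_two_homotopySphere_gk` — stated for CLOSED,
CONNECTED, ORIENTED trisected `X ≃ₕ S⁴`.  Here we show that the route item is *literally
equivalent* to that fact at universe `0` (`LowGenusBase_iff_mz`): over the bare binders,
compactness comes from the trisection itself (`IsGKTrisection.compactSpace`: three compact
sectors cover `M`), connectedness from simple connectivity of `S⁴` transported along `e`
(`simplyConnectedSpace_sphere_four_holds`, `HomotopyEquiv.simplyConnectedSpace`), and a smooth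
orientation from the tree's proved `isOrientable_of_homotopyEquiv_sphere_four_holds`
(Lee, Thm. 15.43).  Consequently the item also follows from the single MSZ fact
`msz_homotopySphere_gk` (`LowGenusBase_of_msz`, through the tree's proved Euler-characteristic
reduction `mz_genus_le_two_homotopySphere_gk_of_msz_alone`: `χ = 2` forces `g = k₀ + k₁ + k₂`, so a
genus-`≤ 2` trisection of a homotopy sphere has some `kᵢ ≥ g - 1`).

Status: CONDITIONAL on `mz_genus_le_two_homotopySphere_gk` (equivalently, given the tree, on
`msz_homotopySphere_gk`).  No unconditional proof is attempted: already the genus-`0` case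
`(0; 0,0,0)` contains every twisted sphere `D⁴ ∪_φ D⁴` (split one ball into two half-balls), so
`LowGenusBase` implies Cerf's `Γ₄ = 0` (`Literature.Topology.FourManifolds.cerf_twistedSphere_four`,
undischarged), and genus `1`, `2` add Property R–type Dehn-surgery input (MSZ §4).

References: [MeierSchirmerZupan2016] arXiv:1507.06561 Thm. 1.2, Remark 3.12 · [MeierZupan2017]
arXiv:1410.8133 Thm. 1.3 · [GayKirby2016] Def. 1, Remark 2 · [LeeSmoothManifolds2013] Thm. 15.43.
-/

-- the registered namespace `Summit.SmoothPoincare4.SmoothPoincare4.Theorems` repeats a component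
set_option linter.dupNamespace false

noncomputable section

namespace Summit.SmoothPoincare4.SmoothPoincare4.Theorems

open scoped Manifold ContDiff
open Summit.SmoothPoincare4.SmoothPoincare4.Theses.WeakReductionDescent

/-- **`LowGenusBase` from the Meier–Zupan / MSZ homotopy-sphere fact.**  Given
`mz_genus_le_two_homotopySphere_gk` (closed connected oriented trisected `X ≃ₕ S⁴` of genus `≤ 2`
is `≅ S⁴`), the route item over the bare binders follows: `M` is compact because the three compact
sectors cover it, connected because `S⁴` is simply connected and simple connectivity transports
along `e : M ≃ₕ S⁴`, and smoothly orientable by Lee's Thm. 15.43 (tree theorem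
`isOrientable_of_homotopyEquiv_sphere_four_holds`).  CONDITIONAL on the named fact `hMZ`.
[cite: MeierZupan2017, Thm. 1.2 (arXiv Thm. 1.3)] [cite: MeierSchirmerZupan2016, Thm. 1.2 (arXiv numbering)] -/
theorem LowGenusBase_of_mz
    (hMZ : Literature.Barriers.SmoothPoincare4.mz_genus_le_two_homotopySphere_gk.{0}) :
    Summit.SmoothPoincare4.SmoothPoincare4.Theses.WeakReductionDescent.LowGenusBase := by
  unfold LowGenusBase
  intro M _ _ _ _ _ e g k T hT hg
  haveI : CompactSpace M := hT.compactSpace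
  haveI : SimplyConnectedSpace (Metric.sphere (0 : EuclideanSpace ℝ (Fin 5)) 1) :=
    Literature.Topology.FourManifolds.simplyConnectedSpace_sphere_four_holds
  haveI : SimplyConnectedSpace M := e.simplyConnectedSpace
  obtain ⟨o⟩ :=
    Literature.Topology.FourManifolds.isOrientable_of_homotopyEquiv_sphere_four_holds M e
  exact hMZ M o g k T hT hg e

/-- **`LowGenusBase` from the MSZ fact alone.**  Meier–Schirmer–Zupan's Thm. 1.2 in
homotopy-sphere form (`msz_homotopySphere_gk`: some `kᵢ ≥ g - 1` ⇒ `X ≅ S⁴`) implies the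
genus-`≤ 2` fact by the tree's proved Euler-characteristic reduction
(`mz_genus_le_two_homotopySphere_gk_of_msz_alone`: `χ(X) = 2 + g - Σ kᵢ = 2` forces
`g = k₀ + k₁ + k₂`, so `g ≤ 2` leaves only types with some `kᵢ ≥ g - 1`), hence the route item.
CONDITIONAL on the named fact `hMSZ`.
[cite: MeierSchirmerZupan2016, Thm. 1.2 and Remark 3.12] [cite: GayKirby2016, Remark 2] -/
theorem LowGenusBase_of_msz
    (hMSZ : Literature.Barriers.SmoothPoincare4.msz_homotopySphere_gk.{0}) :
    Summit.SmoothPoincare4.SmoothPoincare4.Theses.WeakReductionDescent.LowGenusBase :=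
  LowGenusBase_of_mz
    (Literature.Barriers.SmoothPoincare4.mz_genus_le_two_homotopySphere_gk_of_msz_alone hMSZ)

/-- **Converse: the route item implies the Meier–Zupan / MSZ homotopy-sphere fact** (universe
`0`): forget compactness, connectedness and the orientation.  So `LowGenusBase` is not weaker than
the tree's named fact. [cite: MeierZupan2017, Thm. 1.2 (arXiv Thm. 1.3)] -/
theorem mz_genus_le_two_homotopySphere_gk_of_LowGenusBase
    (h : Summit.SmoothPoincare4.SmoothPoincare4.Theses.WeakReductionDescent.LowGenusBase) :
    Literature.Barriers.SmoothPoincare4.mz_genus_le_two_homotopySphere_gk.{0} := by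
  intro X _ _ _ _ _ _ _ _ g k S hT hg e
  exact h X e g k S hT hg

/-- **The route item `LowGenusBase` is literally the tree's named fact
`mz_genus_le_two_homotopySphere_gk` at universe `0`** (Meier–Zupan 2017 Thm. 1.2 /
Meier–Schirmer–Zupan 2016 Thm. 1.2, homotopy-sphere corollary over `IsGKTrisection`): the item
closes exactly when that fact is discharged. [cite: MeierZupan2017, Thm. 1.2 (arXiv Thm. 1.3)]
[cite: MeierSchirmerZupan2016, Thm. 1.2 (arXiv numbering)] -/
theorem LowGenusBase_iff_mz :
    Summit.SmoothPoincare4.SmoothPoincare4.Theses.WeakReductionDescent.LowGenusBase ↔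
      Literature.Barriers.SmoothPoincare4.mz_genus_le_two_homotopySphere_gk.{0} :=
  ⟨mz_genus_le_two_homotopySphere_gk_of_LowGenusBase, LowGenusBase_of_mz⟩

end Summit.SmoothPoincare4.SmoothPoincare4.Theorems

end

/-!
## Part II (seat c1, 2026-08-17): the item is the catalogued barrier, and its two classical slices

Three further kernel-checked facts about the support item `LowGenusBase`, all unconditional:

* `LowGenusBase_iff_lowGenusTrisectionBarrier` — the route item is *literally* the catalogued
  barrier statement `Literature.Barriers.SmoothPoincare4.LowGenusTrisectionBarrier`
  ("no exotic 4-sphere has a trisection of genus `≤ 2`"), whose trust base in the tree is the single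
  named fact `msz_homotopySphere_gk` (`msz_iff_lowGenus_and_largeK`).
* `genus_eq_sum_of_isGKTrisection_of_homotopyEquiv` — Gay–Kirby's Remark 2 / MSZ Remark 3.12
  (`g = k₀ + k₁ + k₂`, PROVED in the tree as
  `gkTrisection_genus_eq_sum_of_homotopyEquiv_sphere_holds`) transported to the Statement's bare
  binders (compactness from the trisection, orientation from Lee's Thm. 15.43).
* `exists_perm_type_of_genus_le_two`, `LowGenusBase_of_cases`, `LowGenusBase_iff_cases` — hence a
  genus-`≤ 2` trisection of a homotopy 4-sphere is, after relabelling the sectors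
  (`IsGKTrisection.comp_perm`), of type `(g; g, 0, 0)` (`g ≤ 2`) or `(2; 1, 1, 0)`, and the item is
  EQUIVALENT to the conjunction of the two normalised slices:
  (A) `(g; g,0,0)`-trisected homotopy 4-spheres are `S⁴` — classically: two sectors are 4-balls and
  the third, `♮ᵍ(S¹ × B³)`, is attached without 2-handles (Gay–Kirby Lemma 13), so `X = D⁴ ∪_φ D⁴`
  is a twisted sphere and the slice is Cerf's `Γ₄ = 0` (tree fact `cerf_twistedSphere_four`,
  unproved) in trisection clothing;
  (B) `(2; 1,1,0)`-trisected homotopy 4-spheres are `S⁴` — classically: `X = (D⁴ ∪ h²) ∪ (S¹ × B³)`,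
  the knot trace has boundary `S¹ × S²`, so the knot is trivial by Gabai's Property R and
  `X ≅ S² × D² ∪ S¹ × B³ ≅ S⁴` by Laudenbach–Poénaru (tree fact `exists_diffeomorph_comp_incl_eq`,
  unproved) — the `g = 2` instance of Meier–Schirmer–Zupan's Thm. 1.2.
  Neither slice is proved here; the split records exactly which two classical theorems the rung
  `g ≤ 2` consists of.

References: [GayKirby2016] Remark 2, Lemma 13 · [MeierSchirmerZupan2016] Thm. 1.2, Remark 3.12, §4 ·
[Gabai1987] Cor. 8.3 (Property R) · [Cerf1968] (Γ₄ = 0) · [LaudenbachPoenaru1972] Thm. A.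
-/

noncomputable section

namespace Summit.SmoothPoincare4.SmoothPoincare4.Theorems

open scoped Manifold ContDiff ContinuousMap
open Summit.SmoothPoincare4.SmoothPoincare4.Theses.WeakReductionDescent

/-- **The route item `LowGenusBase` is literally the catalogued barrier statement
`LowGenusTrisectionBarrier`** (`¬ ExoticTrisectedSphereOfGenusLE 2`: no closed connected oriented
smooth `X ≃ₕ S⁴` with a Gay–Kirby trisection of genus `≤ 2` fails to be diffeomorphic to `S⁴`):
both are equivalent to `mz_genus_le_two_homotopySphere_gk.{0}` (`LowGenusBase_iff_mz`,
`lowGenusTrisectionBarrier_iff_mz`). [cite: MeierZupan2017, Thm. 1.2 (arXiv Thm. 1.3)]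
[cite: MeierSchirmerZupan2016, Thm. 1.2 (arXiv numbering)] -/
theorem LowGenusBase_iff_lowGenusTrisectionBarrier :
    Summit.SmoothPoincare4.SmoothPoincare4.Theses.WeakReductionDescent.LowGenusBase ↔
      Literature.Barriers.SmoothPoincare4.LowGenusTrisectionBarrier :=
  LowGenusBase_iff_mz.trans Literature.Barriers.SmoothPoincare4.lowGenusTrisectionBarrier_iff_mz.symm

/-- **`g = k₀ + k₁ + k₂` for a trisected homotopy 4-sphere, over the Statement's bare binders**
(Gay–Kirby Remark 2 / Meier–Schirmer–Zupan Remark 3.12 with `χ = 2`): the tree's PROVED fact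
`gkTrisection_genus_eq_sum_of_homotopyEquiv_sphere_holds` needs `X` compact and a smooth orientation;
here compactness comes from the trisection (`IsGKTrisection.compactSpace`) and the orientation from
`isOrientable_of_homotopyEquiv_sphere_four_holds` (Lee, Thm. 15.43).  Unconditional.
[cite: GayKirby2016, Remark 2] [cite: MeierSchirmerZupan2016, Remark 3.12] -/
theorem genus_eq_sum_of_isGKTrisection_of_homotopyEquiv
    (M : Type) [TopologicalSpace M] [T2Space M] [SecondCountableTopology M]
    [ChartedSpace (EuclideanSpace ℝ (Fin 4)) M] [IsManifold (𝓡 4) ∞ M]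
    (e : M ≃ₕ Metric.sphere (0 : EuclideanSpace ℝ (Fin 5)) 1)
    {g : ℕ} {k : Fin 3 → ℕ} {T : Fin 3 → Set M}
    (hT : Literature.Topology.FourManifolds.IsGKTrisection M g k T) : g = k 0 + k 1 + k 2 := by
  haveI : CompactSpace M := hT.compactSpace
  obtain ⟨o⟩ :=
    Literature.Topology.FourManifolds.isOrientable_of_homotopyEquiv_sphere_four_holds M e
  exact Literature.Topology.FourManifolds.gkTrisection_genus_eq_sum_of_homotopyEquiv_sphere_holds
    M o g k T hT e

/-- The three transpositions of `Fin 3` evaluated on a handle-count vector `k` (bookkeeping for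
relabelling the sectors of a trisection). [folklore] -/
theorem comp_swap_apply (k : Fin 3 → ℕ) :
    ((k ∘ ⇑(Equiv.swap (0 : Fin 3) 1)) 0 = k 1 ∧ (k ∘ ⇑(Equiv.swap (0 : Fin 3) 1)) 1 = k 0 ∧
        (k ∘ ⇑(Equiv.swap (0 : Fin 3) 1)) 2 = k 2) ∧
      ((k ∘ ⇑(Equiv.swap (0 : Fin 3) 2)) 0 = k 2 ∧ (k ∘ ⇑(Equiv.swap (0 : Fin 3) 2)) 1 = k 1 ∧
        (k ∘ ⇑(Equiv.swap (0 : Fin 3) 2)) 2 = k 0) ∧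
      ((k ∘ ⇑(Equiv.swap (1 : Fin 3) 2)) 0 = k 0 ∧ (k ∘ ⇑(Equiv.swap (1 : Fin 3) 2)) 1 = k 2 ∧
        (k ∘ ⇑(Equiv.swap (1 : Fin 3) 2)) 2 = k 1) := by
  simp [Equiv.swap_apply_def]

/-- **The genus-`≤ 2` trisection types of a homotopy 4-sphere.**  If a smooth homotopy 4-sphere
`M` (bare binders, `e : M ≃ₕ S⁴`) carries a `(g; k₀, k₁, k₂)` Gay–Kirby trisection with `g ≤ 2`,
then `g = k₀ + k₁ + k₂` leaves, up to relabelling the sectors by a permutation `σ` of `Fin 3`,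
exactly the types `(g; g, 0, 0)` (`g = 0, 1, 2`) and `(2; 1, 1, 0)` — Meier–Schirmer–Zupan's list
`(0;0,0,0)`, `(1;1,0,0)`, `(2;2,0,0)`, `(2;1,1,0)` for trisections of `S⁴` of genus `≤ 2`
(Remark 3.12), here for every homotopy 4-sphere.  Unconditional.
[cite: MeierSchirmerZupan2016, Remark 3.12] [cite: GayKirby2016, Remark 2] -/
theorem exists_perm_type_of_genus_le_two
    (M : Type) [TopologicalSpace M] [T2Space M] [SecondCountableTopology M]
    [ChartedSpace (EuclideanSpace ℝ (Fin 4)) M] [IsManifold (𝓡 4) ∞ M]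
    (e : M ≃ₕ Metric.sphere (0 : EuclideanSpace ℝ (Fin 5)) 1)
    {g : ℕ} {k : Fin 3 → ℕ} {T : Fin 3 → Set M}
    (hT : Literature.Topology.FourManifolds.IsGKTrisection M g k T) (hg : g ≤ 2) :
    ∃ σ : Equiv.Perm (Fin 3),
      ((k ∘ ⇑σ) 0 = g ∧ (k ∘ ⇑σ) 1 = 0 ∧ (k ∘ ⇑σ) 2 = 0) ∨
        (g = 2 ∧ (k ∘ ⇑σ) 0 = 1 ∧ (k ∘ ⇑σ) 1 = 1 ∧ (k ∘ ⇑σ) 2 = 0) := by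
  have hsum := genus_eq_sum_of_isGKTrisection_of_homotopyEquiv M e hT
  obtain ⟨⟨h01a, h01b, h01c⟩, ⟨h02a, h02b, h02c⟩, ⟨h12a, h12b, h12c⟩⟩ := comp_swap_apply k
  have hid : ∀ i, (k ∘ ⇑(1 : Equiv.Perm (Fin 3))) i = k i := fun i => by simp
  have hid0 := hid 0
  have hid1 := hid 1
  have hid2 := hid 2
  by_cases hk1 : k 1 = 0
  · by_cases hk2 : k 2 = 0
    · -- type `(g, 0, 0)`: no relabelling
      exact ⟨1, Or.inl ⟨by omega, by omega, by omega⟩⟩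
    · by_cases hk0 : k 0 = 0
      · -- type `(0, 0, g)`: swap sectors `0` and `2`
        exact ⟨Equiv.swap 0 2, Or.inl ⟨by omega, by omega, by omega⟩⟩
      · -- type `(1, 0, 1)`: swap sectors `1` and `2`
        exact ⟨Equiv.swap 1 2, Or.inr ⟨by omega, by omega, by omega, by omega⟩⟩
  · by_cases hk0 : k 0 = 0
    · by_cases hk2 : k 2 = 0
      · -- type `(0, g, 0)`: swap sectors `0` and `1`
        exact ⟨Equiv.swap 0 1, Or.inl ⟨by omega, by omega, by omega⟩⟩
      · -- type `(0, 1, 1)`: swap sectors `0` and `2`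
        exact ⟨Equiv.swap 0 2, Or.inr ⟨by omega, by omega, by omega, by omega⟩⟩
    · -- type `(1, 1, 0)`: no relabelling
      exact ⟨1, Or.inr ⟨by omega, by omega, by omega, by omega⟩⟩

/-- **`LowGenusBase` from its two normalised slices.**  Since the sectors of a Gay–Kirby
trisection may be relabelled (`IsGKTrisection.comp_perm`) and a genus-`≤ 2` trisection of a
homotopy 4-sphere is of type `(g; g, 0, 0)` or `(2; 1, 1, 0)` up to relabelling
(`exists_perm_type_of_genus_le_two`), the item follows from:
(A) `hA` — every smooth homotopy 4-sphere with a `(g; g, 0, 0)` trisection, `g ≤ 2`, is `≅ S⁴`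
(classically: the sectors with `k = 0` are 4-balls and `♮ᵍ(S¹ × B³)` is attached to one of them
without 2-handles, Gay–Kirby Lemma 13, so `X = D⁴ ∪_φ D⁴` is a twisted sphere and (A) is Cerf's
`Γ₄ = 0` — tree fact `Literature.Topology.FourManifolds.cerf_twistedSphere_four`, unproved);
(B) `hB` — every smooth homotopy 4-sphere with a `(2; 1, 1, 0)` trisection is `≅ S⁴` (classically:
`X = (D⁴ ∪ h²) ∪ S¹ × B³`, the knot trace has boundary `S¹ × S²`, so by Gabai's Property R the knot
is trivial, `D⁴ ∪ h² ≅ S² × D²`, and `X ≅ S⁴` by Laudenbach–Poénaru — the `g = 2` case of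
Meier–Schirmer–Zupan's Thm. 1.2).  Neither slice is proved in the tree; this theorem only records
the split.  [cite: MeierSchirmerZupan2016, Thm. 1.2 and §4] [cite: GayKirby2016, Lemma 13]
[cite: Gabai1987, Cor. 8.3] [cite: Cerf1968, Γ₄ = 0] -/
theorem LowGenusBase_of_cases
    (hA : ∀ (M : Type) [TopologicalSpace M] [T2Space M] [SecondCountableTopology M]
      [ChartedSpace (EuclideanSpace ℝ (Fin 4)) M] [IsManifold (𝓡 4) ∞ M],
      (M ≃ₕ Metric.sphere (0 : EuclideanSpace ℝ (Fin 5)) 1) →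
      ∀ (g : ℕ) (k : Fin 3 → ℕ) (T : Fin 3 → Set M),
      Literature.Topology.FourManifolds.IsGKTrisection M g k T → g ≤ 2 →
      k 0 = g → k 1 = 0 → k 2 = 0 →
      Nonempty (Diffeomorph (𝓡 4) (𝓡 4) M (Metric.sphere (0 : EuclideanSpace ℝ (Fin 5)) 1) ∞))
    (hB : ∀ (M : Type) [TopologicalSpace M] [T2Space M] [SecondCountableTopology M]
      [ChartedSpace (EuclideanSpace ℝ (Fin 4)) M] [IsManifold (𝓡 4) ∞ M],
      (M ≃ₕ Metric.sphere (0 : EuclideanSpace ℝ (Fin 5)) 1) →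
      ∀ (k : Fin 3 → ℕ) (T : Fin 3 → Set M),
      Literature.Topology.FourManifolds.IsGKTrisection M 2 k T →
      k 0 = 1 → k 1 = 1 → k 2 = 0 →
      Nonempty (Diffeomorph (𝓡 4) (𝓡 4) M (Metric.sphere (0 : EuclideanSpace ℝ (Fin 5)) 1) ∞)) :
    Summit.SmoothPoincare4.SmoothPoincare4.Theses.WeakReductionDescent.LowGenusBase := by
  unfold LowGenusBase
  intro M _ _ _ _ _ e g k T hT hg
  obtain ⟨σ, h⟩ := exists_perm_type_of_genus_le_two M e hT hg
  have hT' := hT.comp_perm σ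
  rcases h with ⟨h0, h1, h2⟩ | ⟨rfl, h0, h1, h2⟩
  · exact hA M e g (k ∘ ⇑σ) (T ∘ ⇑σ) hT' hg h0 h1 h2
  · exact hB M e (k ∘ ⇑σ) (T ∘ ⇑σ) hT' h0 h1 h2

/-- **The split is exact**: `LowGenusBase` is equivalent to the conjunction of its two normalised
slices (A) `(g; g, 0, 0)`, `g ≤ 2` (twisted-sphere / Cerf grade) and (B) `(2; 1, 1, 0)`
(Property R grade); the forward direction is specialisation. [cite: MeierSchirmerZupan2016, Thm. 1.2 and Remark 3.12] -/
theorem LowGenusBase_iff_cases :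
    Summit.SmoothPoincare4.SmoothPoincare4.Theses.WeakReductionDescent.LowGenusBase ↔
      (∀ (M : Type) [TopologicalSpace M] [T2Space M] [SecondCountableTopology M]
        [ChartedSpace (EuclideanSpace ℝ (Fin 4)) M] [IsManifold (𝓡 4) ∞ M],
        (M ≃ₕ Metric.sphere (0 : EuclideanSpace ℝ (Fin 5)) 1) →
        ∀ (g : ℕ) (k : Fin 3 → ℕ) (T : Fin 3 → Set M),
        Literature.Topology.FourManifolds.IsGKTrisection M g k T → g ≤ 2 →
        k 0 = g → k 1 = 0 → k 2 = 0 →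
        Nonempty (Diffeomorph (𝓡 4) (𝓡 4) M (Metric.sphere (0 : EuclideanSpace ℝ (Fin 5)) 1) ∞)) ∧
      (∀ (M : Type) [TopologicalSpace M] [T2Space M] [SecondCountableTopology M]
        [ChartedSpace (EuclideanSpace ℝ (Fin 4)) M] [IsManifold (𝓡 4) ∞ M],
        (M ≃ₕ Metric.sphere (0 : EuclideanSpace ℝ (Fin 5)) 1) →
        ∀ (k : Fin 3 → ℕ) (T : Fin 3 → Set M),
        Literature.Topology.FourManifolds.IsGKTrisection M 2 k T →
        k 0 = 1 → k 1 = 1 → k 2 = 0 →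
        Nonempty (Diffeomorph (𝓡 4) (𝓡 4) M (Metric.sphere (0 : EuclideanSpace ℝ (Fin 5)) 1) ∞)) := by
  constructor
  · intro h
    exact ⟨fun M _ _ _ _ _ e g k T hT hg _ _ _ => h M e g k T hT hg,
      fun M _ _ _ _ _ e k T hT _ _ _ => h M e 2 k T hT le_rfl⟩
  · rintro ⟨hA, hB⟩
    exact LowGenusBase_of_cases hA hB

end Summit.SmoothPoincare4.SmoothPoincare4.Theorems

end
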